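import Literature.MathematicalPhysics.QuantumFieldTheory.Balaban1983to89.B16RLeafRecord13AtLive

/-!
# `Balaban1983to89.B14NodeKnitRecord13R` — YM-DAG node N11 ([Balaban1988Convergent] Thm 1 p. 262) with 𝐑 EXPLICIT AND PRINT-FAITHFUL at NODE 00's STAGE-13 RECORD:
# [III]'s Theorem of p. 245 (`B14.ThmP245PrintedI` ∕ `…SpacesI`) and p. 244 assumption (`B14.RAssumedP244`) READ AT THE STAGE-13 OBJECTS OF RECORD, Theorem 1 relative
# to 𝐑, the node with 𝐑 consumed from its own antecedent, the (B)-face's first conjunct from [III]'s two sentences — the ₁₃ twin of `…B14NodeKnitRecord12R`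

statement-level bookkeeping over published theorems with citation tags; kernel-checked compositions of tree theorems;
nothing here is a claim about the Yang–Mills mass gap.

Cell `pub-ymgap` (HUMAN RULING D-0062, Track A), seat `pub-ymgap-dag-n11-e` (R134 fan-out row N11∕s3 «`ThmP245Printed` :375 via `rOperation` from N13's `ROpLeaf`
(pairs with n13-c)»), generation 5.  [III] = [Balaban1988Convergent], [B16] = [Balaban1989LargeFieldII].  The ₁₃ twin of this seat's g2 module `…B14NodeKnitRecord12R`
(p460571), re-keyed `₁₂ ↦ ₁₃` at node00-def-T's `Node00/Record13.lean` v1.1 (`VOfRecord₁₃`, `SLaw₁₃`∕`TLaw₁₃`, `rOpLeaf_VOfRecord₁₃_iff`, `densOfRecord₁₃`∕`tdensOfRecord₁₃`,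
`coreOfRecord₁₃`∕`towerOfRecord₁₃`∕`datumOfRecord₁₃`, `upOfRecord₅C … (θ.toStage5₁₃ F N)`, `IsRecordOfRecord₁₃C`, `thm1Printed_datumOfRecord₁₃_of_tLaw_rOpLeaf`), with
the induction and the node taken BY NAME from this seat's `…B16RLeafRecord13Live` (`sLaw₁₃_all_of_laws`, `densitiesDescribed_at_record₁₃_of_laws`,
`b14_main_at_record₁₃_of_rOpLeaf`, and — for §5's live-line corollaries — `rOpLeaf_VOfRecord₁₃_of_liveSel` and `…B16RLeafRecord13AtLive`'s faces at node00-def-K0a's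
witness of record `theta13LiveOfRecord`).

WHY THIS FILE (what s3 adds next to s1∕s2 at Stage 13).  Seat dag-n11-d's `Summits/…/BalabanUVNodesN11AtRecord13C` (p489965) and dag-n24-c's
`…B16NodeKnitRecord13` (p489247) state N11 at ₁₃ in SLOT currency with the (𝐑) antecedent READ through the pin `rOperation_iff_laws₁₃` (the leaf unfolded into
law transport).  Here nothing is unfolded inside a statement: 𝐑 stays the Prop print assumes — `B14.RAssumedP244` at the carriers of record ∕ `ROpLeaf (VOfRecord₁₃ …)`
— and the Theorem of p. 245 keeps [III]'s own slot names `B14.ThmP245PrintedI` ∕ `B14.ThmP245SpacesI` (sequence and space readings, for ANY transformation family `T`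
agreeing with the tower on the trajectory of record): §1 the leaf at a ₁₃-bound run IS `ROpLeaf (VOfRecord₁₃ θ P)` IS `RAssumedP244` at the carriers of record
(`Iff.rfl` ×2) and is YIELDED by N13's node statement (`rOpLeaf₁₃_of_b16_main`); §2 the four dictionaries «[III]'s sentence at the objects of record ↔ law form»;
§3 THEOREM 1 relative to 𝐑 with NO start slot (`sLaw₁₃_all_of_rAssumedP244`; start = `sLaw₁₃_zero`), what it SAYS (`hasSect2FormAEZ_all_of_rAssumedP244`), and
`densitiesDescribed` at a bound world from the junction Prop; §4 the node side (the node with 𝐑 consumed from its own antecedent is this seat's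
`B16RLeafRecord13Live.b14_main_at_record₁₃_of_rOpLeaf`, NOT restated here): the two A4 locators `sLaw₁₃_all_of_b14_main_of_rOpLeaf` (what N11 SAYS given its
antecedents, 𝐑 as print assumes it) and `sLaw₁₃_all_of_b16_main_of_slots` (Theorem 1 at a ₁₃-bound run from N13's statement + N11's one slot, the junction BY NAME),
and `b14_main_at_record₁₃_of_b16_main` (the node from N13's statement + (S1ᵀ)); §5 the (B)-face's first conjunct
`B16.Thm1Printed (datumOfRecord₁₃ θ h).C` FROM [III]'s TWO SENTENCES IN [III]'s CURRENCY (`thm1Printed_datumOfRecord₁₃_of_laws_rAssumedP244`,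
`thm1Printed_datumOfRecord₁₃_of_thmP245I_rAssumedP244`) and — the director's row literally, ON THE LIVE-SELECTOR LINE where N13's leaf is a theorem of
`…B16RLeafRecord13Live` §6 — ★ `thm1Printed_datumOfRecord₁₃_of_thmP245I_of_liveSel`: «`ThmP245Printed` via `rOperation` from N13's `ROpLeaf`» with the `ROpLeaf` SUPPLIED,
and ★★ `thm1Printed_datumOfRecord₁₃_theta13LiveOfRecord_of_thmP245I`: the same AT THE K0‴ WITNESS OF RECORD `theta13LiveOfRecord F N` from `Provisos₁₃` there and
[III]'s Theorem of p. 245 in its own name — NOTHING ELSE; §6 the (D, w)-face keyed on `IsRecordOfRecord₁₃C`.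

HONEST FRAMING.  Dictionary ∕ composition bookkeeping; 0 `def`; the Theorem of p. 245 (Sects. 1–3 of [III]) and, off the live line, the p. 244 assumption ([B16]
Thm 1) are DISPLAYED hypotheses; the `T`-family binder ranges over the cell's `RTOpI` carrier (dictionary-level only; the load-bearing content is the law reading);
nothing of Bałaban's analysis is asserted; N11 NOT discharged; K1‴ (stmt-QuantumFields-19910) NOT closed; counts unmoved; general `N`; one finite `𝕋⁴_{L^K}`
programme at fixed `ε = L^{−K}` — NOT a continuum ∕ OS ∕ mass-gap ∕ Clay statement.
-/

noncomputable section

open MeasureTheory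
open scoped BigOperators Matrix.Norms.L2Operator

namespace Literature.MathematicalPhysics.QuantumFieldTheory.Balaban1983to89.B14NodeKnitRecord13R

open T4Continuum T4DatumAssembly Node00 B14.Eq218Concrete DagBinding
open B16RLeafRecord13Live
open B14NodeKnitTowerDatum (densitiesDescribed_iff_core)

variable (F : T4Family) (N : ℕ) [NeZero N]

/-! ## §1. The 𝐑-antecedent at Stage 13, PRINT-FAITHFUL: the leaf at the carriers of record, by name, and as [III]'s p. 244 sentence -/

section Leaf

variable (θ : Stage13Params F N) (w : WorldP) (P : B12.RunParams)

/-- **THE 𝐑-ANTECEDENT OF N11 AT A STAGE-13-BOUND RUN IS THE LEAF AT THE CARRIERS OF RECORD** (the junction Prop with N13, BY NAME): at `w.up P = upOfRecord₅C F N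
(θ.toStage5₁₃ F N) P`, `(leavesP w P).rOperation ↔ ROpLeaf (VOfRecord₁₃ F N θ P)` (`Iff.rfl` behind the binding equation; nothing unfolded — the law-transport
unfolding is dag-n24-c's `rOperation_iff_laws₁₃`). [cite: Balaban1988Convergent, p.244 (bookkeeping: the leaf named)] -/
theorem rOperation_iff_rOpLeaf₁₃ (hup : w.up P = upOfRecord₅C F N (θ.toStage5₁₃ F N) P) :
    (leavesP w P).rOperation ↔ ROpLeaf (VOfRecord₁₃ F N θ P) := by
  show (w.up P).rOperation ↔ _
  rw [hup]
  exact Iff.rfl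

/-- **THE LEAF AT THE STAGE-13 CARRIERS OF RECORD IS [III]'s TYPED p. 244 SENTENCE** (`B14.RAssumedP244`, verbatim there: *«we will only assume that it has some
properties incorporated in the inductive description of the effective actions»*) for the density operation, target space and corresponding space OF RECORD along the
run `P` (`Iff.rfl`: `DagBinding.ROpLeaf` is this by definition). [cite: Balaban1988Convergent, p.244] -/
theorem rOpLeaf₁₃_iff_rAssumedP244 :
    ROpLeaf (VOfRecord₁₃ F N θ P) ↔
      B14.RAssumedP244 (VOfRecord₁₃ F N θ P).R (VOfRecord₁₃ F N θ P).Scorr (VOfRecord₁₃ F N θ P).S P.K :=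
  Iff.rfl

/-- **THE PRODUCER'S SIDE OF THE JUNCTION, Stage 13** (node N13 = [Balaban1989LargeFieldII] Thm 1, `Dag.B16_main`, whose conclusion's first conjunct is
`ℓ.rOperation`): at a Stage-13-bound run, N13's node statement with its in-edge leaves and the small-field implication YIELDS the leaf at the carriers of record
`ROpLeaf (VOfRecord₁₃ F N θ P)` — the Prop the dag-n13 lineage is asked to inhabit at Stage 13, BY NAME. [cite: Balaban1989LargeFieldII, Thm 1 p.355 (bookkeeping); Balaban1988Convergent, p.244] -/
theorem rOpLeaf₁₃_of_b16_main (hup : w.up P = upOfRecord₅C F N (θ.toStage5₁₃ F N) P) (hN : Dag.B16_main (leavesP w P))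
    (h5 : (leavesP w P).b5) (h6 : (leavesP w P).b6) (h7 : (leavesP w P).b7) (h9 : (leavesP w P).b9) (h10 : (leavesP w P).b10)
    (h11 : (leavesP w P).b11) (h13 : (leavesP w P).b13) (hrb : (leavesP w P).rBasicStep)
    (hsf : (leavesP w P).smallCouplings → (leavesP w P).smallFieldInductive) :
    ROpLeaf (VOfRecord₁₃ F N θ P) :=
  (rOperation_iff_rOpLeaf₁₃ F N θ w P hup).1 (hN h5 h6 h7 h9 h10 h11 h13 hrb hsf).1

end Leaf

/-! ## §2. [III]'s sentences READ AT THE STAGE-13 OBJECTS OF RECORD: the Theorem of p. 245 (sequence and space readings), the p. 244 assumption -/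

section Sentences

variable (θ : Stage13Params F N) (w : WorldP) (P : B12.RunParams)

/-- **THE THEOREM OF p. 245, SEQUENCE READING, ALONG THE TRAJECTORY OF RECORD, Stage 13** ([Balaban1988Convergent] p. 245, verbatim: *«Theorem. If ρ_k satisfies the
assumptions described in detail in Sect. 2, then Tρ_k satisfies also the corresponding assumptions.»*): with `ρ_k := densOfRecord₁₃ θ P k` in the target space of
record and `𝐓ρ_k := tdensOfRecord₁₃ θ P k` tested in the corresponding space, the sentence IS `∀ k < K, SLaw₁₃ θ P k → TLaw₁₃ θ P k`.  Bookkeeping.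
[cite: Balaban1988Convergent, Theorem p.245; (3.25) p.270] -/
theorem thmP245_at_record₁₃_iff_laws :
    (∀ k, k < P.K → (VOfRecord₁₃ F N θ P).S k (densOfRecord₁₃ F N θ P k) →
        (VOfRecord₁₃ F N θ P).Scorr (k + 1) (tdensOfRecord₁₃ F N θ P k)) ↔
      ∀ k, k < P.K → SLaw₁₃ F N θ P k → TLaw₁₃ F N θ P k := by
  refine ⟨fun h k hk hS => ?_, fun h k hk hS => ?_⟩
  · have hT : tdensOfRecord₁₃ F N θ P k = tdensOfRecord₁₃ F N θ P k ∧ TLaw₁₃ F N θ P k := h k hk ⟨rfl, hS⟩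
    exact hT.2
  · exact ⟨rfl, h k hk hS.2⟩

/-- **[III]'s OWN SLOT NAME AT THE STAGE-13 RECORD**: for ANY family `T` of renormalization transformations on the run's lattices (the cell's carrier `RTOpI` along
the averaging of record) that AGREES WITH THE TOWER ON THE TRAJECTORY (`(T k).T ρ_k = 𝐓ρ_k` of record, `k < K`), the typed Theorem of p. 245
`B14.ThmP245PrintedI T ρ S Scorr K` at `ρ := densOfRecord₁₃ θ P`, the Stage-13 spaces of record and `K := P.K` IS `∀ k < K, SLaw₁₃ θ P k → TLaw₁₃ θ P k`.  (The
`RTOp`-form `B14.ThmP245Printed` is the same Prop along `RTOp.toRTOpI`, `B14.thmP245PrintedI_toRTOpI_iff`.)  Dictionary lemma; the closers below are `T`-free.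
[cite: Balaban1988Convergent, Theorem p.245] -/
theorem thmP245PrintedI_at_record₁₃_iff_laws (T : (k : ℕ) → RTOpI (F.P P.K) k (SU N) (avOfRecord F N P.K k))
    (hT : ∀ k, k < P.K → (T k).T (densOfRecord₁₃ F N θ P k) = tdensOfRecord₁₃ F N θ P k) :
    B14.ThmP245PrintedI T (densOfRecord₁₃ F N θ P) (VOfRecord₁₃ F N θ P).S (VOfRecord₁₃ F N θ P).Scorr P.K ↔
      ∀ k, k < P.K → SLaw₁₃ F N θ P k → TLaw₁₃ F N θ P k := by
  refine ⟨fun h k hk hS => ?_, fun h k hk hS => ?_⟩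
  · have hT' : (T k).T (densOfRecord₁₃ F N θ P k) = tdensOfRecord₁₃ F N θ P k ∧ TLaw₁₃ F N θ P k := h k hk ⟨rfl, hS⟩
    exact hT'.2
  · exact ⟨hT k hk, h k hk hS.2⟩

/-- **THE SPACE READING OF THE THEOREM OF p. 245 AT THE STAGE-13 RECORD COINCIDES WITH THE SEQUENCE READING** ([Balaban1988Convergent] p. 262, second remark: *«…
the operation 𝐑T transforms the space with the index k into the space with the index k+1. This generalization does not seem to be useful, or interesting now.»* —
typed `B14.ThmP245SpacesI`): at the carriers of record the index-`k` space IS `{ρ : ρ = ρ_k ∧ SLaw₁₃ θ P k}`, so for any agreeing `T`-family the space reading IS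
`∀ k < K, SLaw₁₃ θ P k → TLaw₁₃ θ P k`.  Dictionary lemma. [cite: Balaban1988Convergent, Theorem p.245 with remark p.262] -/
theorem thmP245SpacesI_at_record₁₃_iff_laws (T : (k : ℕ) → RTOpI (F.P P.K) k (SU N) (avOfRecord F N P.K k))
    (hT : ∀ k, k < P.K → (T k).T (densOfRecord₁₃ F N θ P k) = tdensOfRecord₁₃ F N θ P k) :
    B14.ThmP245SpacesI T (VOfRecord₁₃ F N θ P).S (VOfRecord₁₃ F N θ P).Scorr P.K ↔
      ∀ k, k < P.K → SLaw₁₃ F N θ P k → TLaw₁₃ F N θ P k := by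
  refine ⟨fun h => ?_, fun h k hk ρ hρ => ?_⟩
  · exact (thmP245PrintedI_at_record₁₃_iff_laws F N θ P T hT).1 (B14.thmP245PrintedI_of_spacesI h (densOfRecord₁₃ F N θ P))
  · obtain ⟨rfl, hS⟩ := hρ
    exact ⟨hT k hk, h k hk hS⟩

/-- **THE p. 244 ASSUMPTION AT THE STAGE-13 CARRIERS OF RECORD IS «𝐓-IMAGE FORM ⇒ §2 FORM ONE LEVEL UP»**: `B14.RAssumedP244` at `VOfRecord₁₃ θ P` ↔
`∀ k < K, TLaw₁₃ θ P k → SLaw₁₃ θ P (k+1)` — node00-def-T's `rOpLeaf_VOfRecord₁₃_iff`, quoted through §1.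
[cite: Balaban1988Convergent, p.244 and Thm 2 p.263 (bookkeeping: the leaf unfolded, by name)] -/
theorem rAssumedP244_at_record₁₃_iff_laws :
    B14.RAssumedP244 (VOfRecord₁₃ F N θ P).R (VOfRecord₁₃ F N θ P).Scorr (VOfRecord₁₃ F N θ P).S P.K ↔
      ∀ k, k < P.K → TLaw₁₃ F N θ P k → SLaw₁₃ F N θ P (k + 1) :=
  (rOpLeaf₁₃_iff_rAssumedP244 F N θ P).symm.trans (rOpLeaf_VOfRecord₁₃_iff F N θ P)

end Sentences

/-! ## §3. THEOREM 1 [III] AT THE STAGE-13 OBJECTS OF RECORD, RELATIVE TO 𝐑 — no world, no binding, NO START SLOT: `θ` and the run `P` only -/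

section Thm1Relative

variable (θ : Stage13Params F N) (P : B12.RunParams)

/-- **THEOREM 1 [III] AT THE OBJECTS OF RECORD, RELATIVE TO 𝐑, THE START A THEOREM** ([Balaban1988Convergent] Thm 1 p. 262; printed proof structure = START +
THE THEOREM OF p. 245 + THE ASSUMED 𝐑 along (0.2)), re-run at the Stage-13 laws of record (base `sLaw₁₃_zero`; the induction is this seat's `sLaw₁₃_all_of_laws`).
Hypotheses, both DISPLAYED and PRINTED: `hR` — `B14.RAssumedP244` at the 𝐑-carriers of record (= `ROpLeaf (VOfRecord₁₃ …)`, N13's product); `hT` — the Theorem of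
p. 245 at the objects of record.  Conclusion: EVERY `ρ_k` of record, `k ≤ K`, has the repaired §2 [III] form of record.  Count-neutral.
[cite: Balaban1988Convergent, Thm 1 p.262; Theorem p.245; p.244] -/
theorem sLaw₁₃_all_of_rAssumedP244
    (hR : B14.RAssumedP244 (VOfRecord₁₃ F N θ P).R (VOfRecord₁₃ F N θ P).Scorr (VOfRecord₁₃ F N θ P).S P.K)
    (hT : ∀ k, k < P.K → SLaw₁₃ F N θ P k → TLaw₁₃ F N θ P k) :
    ∀ k, k ≤ P.K → SLaw₁₃ F N θ P k :=
  sLaw₁₃_all_of_laws F N θ P ((rAssumedP244_at_record₁₃_iff_laws F N θ P).1 hR) hT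

/-- **What Theorem 1 SAYS at Stage 13, relative to 𝐑**: for every `k ≤ K` the post-𝐑 slot family of `ρ_k` of record HAS THE REPAIRED §2 [III] FORM (`HasSect2FormAEZ`)
AT THE 𝐓-WEIGHTS OF RECORD OF THE RUN `WtOfRecord₁₃ θ P` and the repaired backgrounds `UbgOfRecord₁₃` — `Node00.sLaw₁₃_iff`.
[cite: Balaban1988Convergent, Thm 1 p.262, (2.18) p.257, (2.23)–(2.42) pp.258–261] -/
theorem hasSect2FormAEZ_all_of_rAssumedP244
    (hR : B14.RAssumedP244 (VOfRecord₁₃ F N θ P).R (VOfRecord₁₃ F N θ P).Scorr (VOfRecord₁₃ F N θ P).S P.K)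
    (hT : ∀ k, k < P.K → SLaw₁₃ F N θ P k → TLaw₁₃ F N θ P k) (k : ℕ) (hk : k ≤ P.K) :
    HasSect2FormAEZ F N (FluctV N) P.K (settingOfRecord₁₃ F N θ P) (θ.Rz P.K) (WtOfRecord₁₃ F N θ P) k (UbgOfRecord₁₃ F N θ P k)
      (slotsOfRecord F N θ.ν θ.τ9 (EOfRecord₁₃ F N θ) (wOfRecord₉ F N θ.toStage9Params) θ.ppSel P (gOfRecord₁₃ F N θ P) k) :=
  (sLaw₁₃_iff F N θ P k).1 (sLaw₁₃_all_of_rAssumedP244 F N θ P hR hT k hk)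

variable (w : WorldP) (h : θ.Provisos₁₃ F N)

/-- **Theorem 1's conclusion `densitiesDescribed` AT A STAGE-13 WORLD, RELATIVE TO 𝐑** — with 𝐑 displayed as THE LEAF AT THE CARRIERS OF RECORD `ROpLeaf (VOfRecord₁₃
F N θ P)` (the Prop node N13 produces): at `w.C = (datumOfRecord₁₃ F N θ h).C`, the leaf + the Theorem of p. 245 at the objects of record give
`(leavesP w P).densitiesDescribed` — no start hypothesis. [cite: Balaban1988Convergent, Thm 1 p.262; Theorem p.245; p.244] -/
theorem densitiesDescribed_at_record₁₃_of_rOpLeaf (hC : w.C = (datumOfRecord₁₃ F N θ h).C) (hR : ROpLeaf (VOfRecord₁₃ F N θ P))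
    (hT : ∀ k, k < P.K → SLaw₁₃ F N θ P k → TLaw₁₃ F N θ P k) :
    (leavesP w P).densitiesDescribed :=
  densitiesDescribed_at_record₁₃_of_laws F N θ P w h hC ((rOpLeaf_VOfRecord₁₃_iff F N θ P).1 hR) hT

end Thm1Relative

/-! ## §4. THE NODE at a Stage-13 world, A4 locators: what N11 SAYS given its antecedents (𝐑 as print assumes it), and Theorem 1 from the two nodes' products -/

section Node

variable (θ : Stage13Params F N) (h : θ.Provisos₁₃ F N) (w : WorldP) (P : B12.RunParams)

/-- **What N11 SAYS at Stage 13, the 𝐑-antecedent AS PRINT ASSUMES IT** (A4 locator, vacuity audit in kernel form): N11 at a world bound to the datum of record, GIVEN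
its in-edge leaves, the small-field implication, the located flow step, the interval hypothesis, the reading `hV` AND THE LEAF AT THE CARRIERS OF RECORD `ROpLeaf
(VOfRecord₁₃ F N θ P)` — node N13's product, by name — YIELDS the repaired §2 [III] form of every `ρ_k` of record, `∀ k ≤ K, SLaw₁₃ θ P k`.
[cite: Balaban1988Convergent, Thm 1 p.262 (bookkeeping); p.244] -/
theorem sLaw₁₃_all_of_b14_main_of_rOpLeaf (hC : w.C = (datumOfRecord₁₃ F N θ h).C) (hV : ROpLeaf (VOfRecord₁₃ F N θ P) → (leavesP w P).rOperation)
    (hN : Dag.B14_main (leavesP w P))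
    (h7 : (leavesP w P).b7) (h8 : (leavesP w P).b8) (h9 : (leavesP w P).b9) (h10 : (leavesP w P).b10) (h11 : (leavesP w P).b11)
    (hsf : (leavesP w P).smallCouplings → (leavesP w P).smallFieldInductive)
    (hfc : (leavesP w P).smallCouplings → (leavesP w P).flowControl)
    (hR : ROpLeaf (VOfRecord₁₃ F N θ P)) (hsc : (leavesP w P).smallCouplings) :
    ∀ k, k ≤ P.K → SLaw₁₃ F N θ P k :=
  (densitiesDescribed_iff_core F N (coreOfRecord₁₃ F N θ) (towerOfRecord₁₃ F N θ h) w P hC).1 (hN h7 h8 h9 h10 h11 hsf hfc (hV hR) hsc)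

/-- **THEOREM 1 [III] AT A STAGE-13-BOUND RUN FROM THE TWO NODES' PRINTED PRODUCTS, the junction BY NAME** (how `Dag.uv_stability_of_series` hands N13's product to
N11, read at the objects of record): at a run bound by `w.up P = upOfRecord₅C F N (θ.toStage5₁₃ F N) P`, GIVEN node N13's statement `Dag.B16_main (leavesP w P)` with
ITS in-edge leaves and `rBasicStep` — which YIELDS the leaf (§1) —, N11's ONE slot (S1ᵀ) at the objects of record and N11's remaining antecedents: under the interval
hypothesis EVERY `ρ_k` of record, `k ≤ K`, has the repaired §2 [III] form of record.  Pure composition; both nodes' analytic contents stay displayed.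
[cite: Balaban1988Convergent, Thm 1 p.262; Theorem p.245; p.244; Balaban1989LargeFieldII, Thm 1 p.355] -/
theorem sLaw₁₃_all_of_b16_main_of_slots (hup : w.up P = upOfRecord₅C F N (θ.toStage5₁₃ F N) P)
    (hN13 : Dag.B16_main (leavesP w P))
    (h5 : (leavesP w P).b5) (h6 : (leavesP w P).b6) (h7 : (leavesP w P).b7) (h8 : (leavesP w P).b8) (h9 : (leavesP w P).b9)
    (h10 : (leavesP w P).b10) (h11 : (leavesP w P).b11) (h13 : (leavesP w P).b13) (hrb : (leavesP w P).rBasicStep)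
    (hsf : (leavesP w P).smallCouplings → (leavesP w P).smallFieldInductive)
    (hfc : (leavesP w P).smallCouplings → (leavesP w P).flowControl)
    (hT : (leavesP w P).b7 → (leavesP w P).b8 → (leavesP w P).b9 → (leavesP w P).b10 → (leavesP w P).b11 →
      (leavesP w P).smallCouplings → (leavesP w P).smallFieldInductive → (leavesP w P).flowControl →
        ∀ k, k < P.K → SLaw₁₃ F N θ P k → TLaw₁₃ F N θ P k)
    (hsc : (leavesP w P).smallCouplings) : ∀ k, k ≤ P.K → SLaw₁₃ F N θ P k :=
  have hR : ROpLeaf (VOfRecord₁₃ F N θ P) := rOpLeaf₁₃_of_b16_main F N θ w P hup hN13 h5 h6 h7 h9 h10 h11 h13 hrb hsf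
  sLaw₁₃_all_of_rAssumedP244 F N θ P ((rOpLeaf₁₃_iff_rAssumedP244 F N θ P).1 hR) (hT h7 h8 h9 h10 h11 hsc (hsf hsc) (hfc hsc))

/-- **N11 ∧ N13's 𝐑-product AT A STAGE-13-BOUND WORLD, the junction by name**: from N13's node statement (+ its in-edges) and N11's (S1ᵀ), `Dag.B14_main (leavesP w P)`
— this seat's `b14_main_at_record₁₃_of_rOpLeaf` with the leaf READ from N13's statement (§1). [cite: Balaban1988Convergent, Thm 1 p.262; Theorem p.245; p.244; Balaban1989LargeFieldII, Thm 1 p.355] -/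
theorem b14_main_at_record₁₃_of_b16_main (hC : w.C = (datumOfRecord₁₃ F N θ h).C) (hup : w.up P = upOfRecord₅C F N (θ.toStage5₁₃ F N) P)
    (hN13 : Dag.B16_main (leavesP w P))
    (h5 : (leavesP w P).b5) (h6 : (leavesP w P).b6) (h13 : (leavesP w P).b13) (hrb : (leavesP w P).rBasicStep)
    (hT : (leavesP w P).b7 → (leavesP w P).b8 → (leavesP w P).b9 → (leavesP w P).b10 → (leavesP w P).b11 →
      (leavesP w P).smallCouplings → (leavesP w P).smallFieldInductive → (leavesP w P).flowControl →
        ∀ k, k < P.K → SLaw₁₃ F N θ P k → TLaw₁₃ F N θ P k) :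
    Dag.B14_main (leavesP w P) := by
  intro h7 h8 h9 h10 h11 hsf hfc _ hsc
  exact (densitiesDescribed_iff_core F N (coreOfRecord₁₃ F N θ) (towerOfRecord₁₃ F N θ h) w P hC).2
    (sLaw₁₃_all_of_b16_main_of_slots F N θ w P hup hN13 h5 h6 h7 h8 h9 h10 h11 h13 hrb hsf hfc hT hsc)

end Node

/-! ## §5. [V]∕[III] THEOREM 1 AS THE TREE STATES IT (`B16.Thm1Printed` at the Stage-13 datum of record) FROM [III]'s TWO SENTENCES IN [III]'s CURRENCY -/

section Thm1Printed

variable (θ : Stage13Params F N) (h : θ.Provisos₁₃ F N)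

/-- **`B16.Thm1Printed (datumOfRecord₁₃ F N θ h).C` FROM THE THEOREM OF p. 245 AND THE p. 244 ASSUMPTION AT THE OBJECTS OF RECORD, law currency, `T`-free** (the
route's (B)-face first conjunct): along every run whose flow stays in a window `]0, γ]` (`0 < γ`), `hT` (N11's product) and `B14.RAssumedP244` at the Stage-13 carriers
of record (`hR`, N13's product AS [III] ASSUMES IT) give Theorem 1 at the datum — node00-def-T's `thm1Printed_datumOfRecord₁₃_of_tLaw_rOpLeaf` read through §1.
[cite: Balaban1988Convergent, Thm 1 p.262; Theorem p.245; p.244; Balaban1989LargeFieldII, Thm 1 p.355 + p.391] -/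
theorem thm1Printed_datumOfRecord₁₃_of_laws_rAssumedP244 {γ : ℝ} (hγ : 0 < γ)
    (hT : ∀ P : B12.RunParams, ((datumOfRecord₁₃ F N θ h).C P).flow.InInterval γ P.K →
      ∀ k, k < P.K → SLaw₁₃ F N θ P k → TLaw₁₃ F N θ P k)
    (hR : ∀ P : B12.RunParams, ((datumOfRecord₁₃ F N θ h).C P).flow.InInterval γ P.K →
      B14.RAssumedP244 (VOfRecord₁₃ F N θ P).R (VOfRecord₁₃ F N θ P).Scorr (VOfRecord₁₃ F N θ P).S P.K) :
    B16.Thm1Printed (datumOfRecord₁₃ F N θ h).C :=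
  thm1Printed_datumOfRecord₁₃_of_tLaw_rOpLeaf F N θ h hγ hT (fun P hP => (rOpLeaf₁₃_iff_rAssumedP244 F N θ P).2 (hR P hP))

/-- **`B16.Thm1Printed` AT THE STAGE-13 DATUM FROM [III]'s TWO SENTENCES IN [III]'s OWN NAMES** — `B14.ThmP245PrintedI` (the Theorem of p. 245, sequence reading, for
any `T`-family agreeing with the tower on the trajectory of each windowed run) and `B14.RAssumedP244` (p. 244) at the Stage-13 carriers of record: the director's row
«`ThmP245Printed` via `rOperation` from N13's `ROpLeaf`» composed to the (B)-face's first conjunct, by name. [cite: Balaban1988Convergent, Thm 1 p.262; Theorem p.245; p.244; Balaban1989LargeFieldII, Thm 1 p.355] -/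
theorem thm1Printed_datumOfRecord₁₃_of_thmP245I_rAssumedP244 {γ : ℝ} (hγ : 0 < γ)
    (T : (P : B12.RunParams) → (k : ℕ) → RTOpI (F.P P.K) k (SU N) (avOfRecord F N P.K k))
    (hTT : ∀ (P : B12.RunParams) (k : ℕ), k < P.K → (T P k).T (densOfRecord₁₃ F N θ P k) = tdensOfRecord₁₃ F N θ P k)
    (hT : ∀ P : B12.RunParams, ((datumOfRecord₁₃ F N θ h).C P).flow.InInterval γ P.K →
      B14.ThmP245PrintedI (T P) (densOfRecord₁₃ F N θ P) (VOfRecord₁₃ F N θ P).S (VOfRecord₁₃ F N θ P).Scorr P.K)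
    (hR : ∀ P : B12.RunParams, ((datumOfRecord₁₃ F N θ h).C P).flow.InInterval γ P.K →
      B14.RAssumedP244 (VOfRecord₁₃ F N θ P).R (VOfRecord₁₃ F N θ P).Scorr (VOfRecord₁₃ F N θ P).S P.K) :
    B16.Thm1Printed (datumOfRecord₁₃ F N θ h).C :=
  thm1Printed_datumOfRecord₁₃_of_laws_rAssumedP244 F N θ h hγ
    (fun P hP => (thmP245PrintedI_at_record₁₃_iff_laws F N θ P (T P) (hTT P)).1 (hT P hP)) hR

/-- **★ THE DIRECTOR's ROW LITERALLY, ON THE LIVE-SELECTOR LINE: `B16.Thm1Printed` AT THE STAGE-13 DATUM FROM [III]'s THEOREM OF p. 245 IN [III]'s OWN NAME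
(`B14.ThmP245PrintedI`) «via `rOperation` from N13's `ROpLeaf`» WITH THE `ROpLeaf` SUPPLIED** — at a `θ` carrying node00-def-T's live-selector clause `hsel` the leaf
is this seat's theorem `rOpLeaf_VOfRecord₁₃_of_liveSel` (from `Provisos₁₃`, admissibility and the displayed term-constant signs), so the (B)-face's first conjunct rests
on the Theorem of p. 245 ALONE. [cite: Balaban1988Convergent, Theorem p.245, Thm 1 p.262, p.244; Balaban1989LargeFieldII, Thm 1 p.355; Balaban1989LargeFieldI, (0.3) p.176, p.177 (i)–(ii)] -/
theorem thm1Printed_datumOfRecord₁₃_of_thmP245I_of_liveSel (hθ : θ.Admissible F N) (hκ : 0 ≤ θ.s2.lf.κ) (hE₀ : 0 ≤ θ.s2.lf.E₀) (hB₀ : 0 ≤ θ.s2.lf.B₀)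
    (hsel : θ.ppSel = ppSelLiveOfRecord F N θ.ν θ.τ9 (EOfRecord₁₃ F N θ) (wOfRecord₉ F N θ.toStage9Params)) {γ : ℝ} (hγ : 0 < γ)
    (T : (P : B12.RunParams) → (k : ℕ) → RTOpI (F.P P.K) k (SU N) (avOfRecord F N P.K k))
    (hTT : ∀ (P : B12.RunParams) (k : ℕ), k < P.K → (T P k).T (densOfRecord₁₃ F N θ P k) = tdensOfRecord₁₃ F N θ P k)
    (hT : ∀ P : B12.RunParams, ((datumOfRecord₁₃ F N θ h).C P).flow.InInterval γ P.K →
      B14.ThmP245PrintedI (T P) (densOfRecord₁₃ F N θ P) (VOfRecord₁₃ F N θ P).S (VOfRecord₁₃ F N θ P).Scorr P.K) :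
    B16.Thm1Printed (datumOfRecord₁₃ F N θ h).C :=
  thm1Printed_datumOfRecord₁₃_of_thmP245I_rAssumedP244 F N θ h hγ T hTT hT
    (fun P _ => (rOpLeaf₁₃_iff_rAssumedP244 F N θ P).1 (rOpLeaf_VOfRecord₁₃_of_liveSel F N θ P h hθ hκ hE₀ hB₀ hsel))

/-- **★★ THE ROW AT THE K0‴ WITNESS OF RECORD: `B16.Thm1Printed (datumOfRecord₁₃ F N θ₁₃ h).C`, `θ₁₃ = theta13LiveOfRecord F N`, FROM `Provisos₁₃ θ₁₃` AND [III]'s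
THEOREM OF p. 245 IN ITS OWN NAME (`B14.ThmP245PrintedI`, any `T`-family agreeing with the tower on the trajectory) along the windowed runs — NOTHING ELSE**
(admissibility by node00-def-K0a's `admissible_theta13LiveOfRecord`, signs by the family's numerals, the `ROpLeaf` by `…B16RLeafRecord13Live` §6 at the `rfl`
selector clause `B16RLeafRecord13AtLive.liveRepin₁₃_liveSel`).  With K0a's `provisos₁₃_theta13LiveOfRecord_of_bg` the proviso itself costs ROW P11 `bg`.
[cite: Balaban1988Convergent, Theorem p.245, Thm 1 p.262, p.244; Balaban1989LargeFieldII, Thm 1 p.355; Balaban1989LargeFieldI, (0.3) p.176, p.177 (i)–(ii)] -/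
theorem thm1Printed_datumOfRecord₁₃_theta13LiveOfRecord_of_thmP245I (hrec : (theta13LiveOfRecord F N).Provisos₁₃ F N) {γ : ℝ} (hγ : 0 < γ)
    (T : (P : B12.RunParams) → (k : ℕ) → RTOpI (F.P P.K) k (SU N) (avOfRecord F N P.K k))
    (hTT : ∀ (P : B12.RunParams) (k : ℕ), k < P.K →
      (T P k).T (densOfRecord₁₃ F N (theta13LiveOfRecord F N) P k) = tdensOfRecord₁₃ F N (theta13LiveOfRecord F N) P k)
    (hT : ∀ P : B12.RunParams, ((datumOfRecord₁₃ F N (theta13LiveOfRecord F N) hrec).C P).flow.InInterval γ P.K →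
      B14.ThmP245PrintedI (T P) (densOfRecord₁₃ F N (theta13LiveOfRecord F N) P) (VOfRecord₁₃ F N (theta13LiveOfRecord F N) P).S
        (VOfRecord₁₃ F N (theta13LiveOfRecord F N) P).Scorr P.K) :
    B16.Thm1Printed (datumOfRecord₁₃ F N (theta13LiveOfRecord F N) hrec).C :=
  thm1Printed_datumOfRecord₁₃_of_thmP245I_of_liveSel F N (theta13LiveOfRecord F N) hrec (admissible_theta13LiveOfRecord F N)
    (B16RLeafRecord13AtLive.kappa_nonneg_theta13LiveOfFamily F N _ _ _ _) (B16RLeafRecord13AtLive.E0_nonneg_theta13LiveOfFamily F N _ _ _ _)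
    (B16RLeafRecord13AtLive.B0_nonneg_theta13LiveOfFamily F N _ _ _ _)
    (B16RLeafRecord13AtLive.liveRepin₁₃_liveSel F N (theta13OfFamily F N eps0OfRecord₁₃ _ _ _)) hγ T hTT hT

end Thm1Printed

/-! ## §6. KEYED on the (D, w)-interface `IsRecordOfRecord₁₃C`: Theorem 1's conclusion at every run, relative to the world's OWN 𝐑-leaves -/

section Keyed

variable {F N}
variable {D : FiniteEpsData F (SU N)} {w : WorldP}

/-- **THEOREM 1's CONCLUSION AT EVERY RUN OF A STAGE-13 RECORD, RELATIVE TO 𝐑 AND THE THEOREM OF p. 245** (the (D, w)-face of §3): a Stage-13 record `(D, w)`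
PRESENTS parameters `θ` with their provisos and `D = datumOfRecord₁₃ θ hP`, and at every run `P` the world's own 𝐑-antecedent `(leavesP w P).rOperation` (node N13's
product; by the C-binding of record it IS the leaf `ROpLeaf (VOfRecord₁₃ θ P)`, §1) together with the Theorem of p. 245 at the presenting objects of record gives N11's
conclusion leaf `(leavesP w P).densitiesDescribed` — no start slot.  (The keyed NODE statement is seat dag-n11-d's `b14_main_of_isRecordOfRecord₁₃C`.)
[cite: Balaban1988Convergent, Thm 1 p.262; Theorem p.245; p.244; Balaban1989LargeFieldII, Thm 1 p.355 (bookkeeping)] -/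
theorem densitiesDescribed_of_isRecordOfRecord₁₃C_of_rOperation (hrec : IsRecordOfRecord₁₃C F N D w) :
    ∃ (θ : Stage13Params F N) (hP : θ.Provisos₁₃ F N), θ.Admissible F N ∧ D = datumOfRecord₁₃ F N θ hP ∧
      ∀ P : B12.RunParams, (leavesP w P).rOperation → (∀ k, k < P.K → SLaw₁₃ F N θ P k → TLaw₁₃ F N θ P k) →
        (leavesP w P).densitiesDescribed := by
  obtain ⟨θ, hP, hθ, hD, hC, -, -, hup⟩ := hrec
  refine ⟨θ, hP, hθ, hD, fun P hrop hT => ?_⟩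
  exact densitiesDescribed_at_record₁₃_of_rOpLeaf F N θ P w hP (by rw [hC, hD]) ((rOperation_iff_rOpLeaf₁₃ F N θ w P (hup P)).1 hrop) hT

end Keyed

end Literature.MathematicalPhysics.QuantumFieldTheory.Balaban1983to89.B14NodeKnitRecord13R

end
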